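import Mathlib
import Summits.HubbardSuperconductivity.HubbardSuperconductivity.Theses.ChiralWindow
import Literature.MathematicalPhysics.QuantumLattice.FinDimSpectrumProofs
import Literature.MathematicalPhysics.QuantumLattice.TraceInequalitiesProofs
import Literature.MathematicalPhysics.QuantumLattice.PairCorrelations

/-!
# Sketch — crux idea `symmetric-radial-pinning` for crux `ChiralWindow.CwThesis`
(stmt-HubbardSuperconductivity-10438), crux-ideate round 1, ideator 1.

First lemma (FL1, `GoldenThompsonTransfer`): every ground state of a Hermitian `H` inherits a
floor on `⟨ψ, P ψ⟩` (`P ≥ 0`) from TWO THERMAL numbers at any `β`: the "thermally accessible state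
count" `𝒩 = Z(β) e^{βE₀}` and the exponential moment `ω_β(e^{-βsP})` of the Gibbs state —
`βs·⟨ψ,Pψ⟩ ≥ -log 𝒩 - log ω_β(e^{-βsP})` (variational principle + Golden–Thompson).
FL2 (`BorelCantelliSelection`): Borel–Cantelli selection of a doping in a window.
Typed research stubs: `ThermalRadialPinning` (engine), `SublinearSectorEntropy`, and the
composition target `PinningImpliesCwThesis`.
-/

noncomputable section

namespace Summit.HubbardSuperconductivity.HubbardSuperconductivity.Cruxes.CwThesis.SymmetricRadialPinning

open Matrix Literature.MathematicalPhysics.QuantumLattice Literature.Probability.LatticeModels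
open scoped ComplexOrder MatrixOrder Classical

set_option linter.dupNamespace false

/-! ### FL1 — Golden–Thompson transfer from the Gibbs state to EVERY ground state -/

/-- **FL1 (first lemma).** For Hermitian `H`, positive semidefinite `P`, `β, s > 0` and every
normalised ground-state vector `ψ` of `H`:
`β s · re⟨ψ, Pψ⟩ ≥ -(log re Z_β(H) + β E₀(H)) - log re ω_β(e^{-βsP})`,
where `Z_β(H) e^{βE₀} = Σₙ e^{-β(Eₙ-E₀)} =: 𝒩` counts thermally accessible states and
`ω_β = gibbsState β H`. Proof: `E₀(H+sP) ≤ E₀(H) + s⟨ψ,Pψ⟩` (variational) and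
`e^{-βE₀(H+sP)} ≤ tr e^{-β(H+sP)} ≤ tr(e^{-βH} e^{-βsP}) = Z_β(H)·ω_β(e^{-βsP})` (Golden–Thompson). -/
def GoldenThompsonTransfer : Prop :=
  ∀ {m : Type} [Fintype m] [DecidableEq m] [Nonempty m] (H P : Matrix m m ℂ),
    H.IsHermitian → P.PosSemidef → ∀ (β s : ℝ), 0 < β → 0 < s →
    ∀ ψ : m → ℂ, star ψ ⬝ᵥ ψ = 1 → H *ᵥ ψ = ((H.groundEnergy : ℝ) : ℂ) • ψ →
      -(Real.log (partitionFn β H).re + β * H.groundEnergy)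
          - Real.log (gibbsState β H (NormedSpace.exp (-((β * s : ℝ) : ℂ) • P))).re
        ≤ β * s * (star ψ ⬝ᵥ P *ᵥ ψ).re

/-! ### FL2 — Borel–Cantelli selection of the doping -/

/-- **FL2.** If the bad doping sets `B k ⊆ [a,b]` have summable Lebesgue measure, some
`δ ∈ [a,b]` is eventually good. (Mathlib `MeasureTheory.ae_eventually_not_mem` + `volume (Icc a b) = b - a > 0`.) -/
def BorelCantelliSelection : Prop :=
  ∀ (a b : ℝ), a < b → ∀ (B : ℕ → Set ℝ), (∀ k, B k ⊆ Set.Icc a b) →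
    (∑' k, MeasureTheory.volume (B k)) ≠ ⊤ →
      ∃ δ ∈ Set.Icc a b, ∀ᶠ k in Filter.atTop, δ ∉ B k

/-- **FL3 (bookkeeping).** The dopings `δ ∈ [0,1]` whose even particle number
`N_L(δ) = 2⌊(1-δ)L²/2⌋` falls in a finite bad set have measure `≤ 2·#Bad/L²`
(each even `N` has a `δ`-preimage of length `2/L²`). -/
def DopingPreimageMeasure : Prop :=
  ∀ (L : ℕ), 0 < L → ∀ (Bad : Finset ℕ),
    MeasureTheory.volume {δ : ℝ | δ ∈ Set.Icc (0:ℝ) 1 ∧ 2 * ⌊(1 - δ) * (L : ℝ) ^ 2 / 2⌋₊ ∈ Bad}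
      ≤ ENNReal.ofReal (2 * Bad.card / (L : ℝ) ^ 2)

/-! ### The sector objects (coordinate form of the `(N, S^z = 0)` sector, as in route AbelianDuality) -/

/-- Occupation sets with `N` particles and `N/2` up-spins: the `(N, S^z = 0)` coordinate sector. -/
def secPred (L N : ℕ) (s : Finset (Orb (FermionTorus 2 L))) : Prop :=
  s.card = N ∧ 2 * (s.filter fun i => (ofLex i).2 = 0).card = N

/-- The Hubbard torus Hamiltonian `hubbardTorus 2 L 1 U` compressed to the sector. -/
def secH (L : ℕ) (U : ℝ) (N : ℕ) :
    Matrix {s // secPred L N s} {s // secPred L N s} ℂ :=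
  (hubbardTorus 2 L 1 U).toBlock (secPred L N) (secPred L N)

/-- The normalised d-wave order observable `Y_L = L⁻⁴ Δ_d† Δ_d` compressed to the sector
(`Δ_d† Δ_d` conserves `N` and `S^z`, so the compression is the restriction). -/
def secY (L : ℕ) [NeZero L] (N : ℕ) :
    Matrix {s // secPred L N s} {s // secPred L N s} ℂ :=
  ((1 / ((L : ℂ) ^ 4)) • ((pairField dWaveFormFactor L)ᴴ * pairField dWaveFormFactor L)).toBlock
    (secPred L N) (secPred L N)

/-! ### Typed research stubs (the line a crux-plan would register) -/

/-- **S1 — thermal radial pinning (the engine stub).** At the "tower temperature"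
`β_L = L²` and Chernoff parameter `λ_L = θL`, in EVERY even sector of the density window
`[1-b, 1-a]`, the canonical Gibbs exponential moment of `Y_L` is `≤ exp(-λ_L r² - cL)`:
the macroscopic d-wave amplitude `|Δ_d|/L²` sits below `r` only with probability `e^{-cL}`
(radial large deviation; rate set by the O(1) phase stiffness, location `r ≍ e^{-C/U²}`). -/
def ThermalRadialPinning (U a b : ℝ) : Prop :=
  ∃ r c θ : ℝ, 0 < r ∧ 0 < c ∧ 0 < θ ∧ ∃ L₀ : ℕ, ∀ (L : ℕ) [NeZero L], L₀ ≤ L → Even L →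
    ∀ N : ℕ, Even N → (1 - b) * (L : ℝ) ^ 2 ≤ N → (N : ℝ) ≤ (1 - a) * (L : ℝ) ^ 2 →
      (gibbsState ((L : ℝ) ^ 2) (secH L U N)
          (NormedSpace.exp (-((θ * L : ℝ) : ℂ) • secY L N))).re
        ≤ Real.exp (-(θ * L * r ^ 2) - c * L)

/-- **S2 — sublinear sector entropy at `β_L = L²`**: `log 𝒩_L = log (Z e^{βE₀}) = o(L)` in
every even sector of the window (physically `𝒩_L → ground degeneracy`: phonon entropy at
`T_L = L⁻²` is `O(L^{2/3})` even in a window of O(1) above `E₀`). -/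
def SublinearSectorEntropy (U a b : ℝ) : Prop :=
  ∀ ε : ℝ, 0 < ε → ∃ L₀ : ℕ, ∀ (L : ℕ) [NeZero L], L₀ ≤ L → Even L →
    ∀ N : ℕ, Even N → (1 - b) * (L : ℝ) ^ 2 ≤ N → (N : ℝ) ≤ (1 - a) * (L : ℝ) ^ 2 →
      Real.log (partitionFn ((L : ℝ) ^ 2) (secH L U N)).re
          + (L : ℝ) ^ 2 * (secH L U N).groundEnergy ≤ ε * L

/-- **Composition target** (to be proved by a crux-plan from FL1 + sector bookkeeping + the
landed even-torus LRO conversion): pinning and sublinear entropy on some window inside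
`[3/10, 12/25]` for every weak `U` give the crux `CwThesis` (with `δ_U :=` any interior point of
the window; floor `r²`). -/
def PinningImpliesCwThesis : Prop :=
  (∃ U₀ : ℝ, 0 < U₀ ∧ ∀ U ∈ Set.Ioo (0:ℝ) U₀, ∃ a b : ℝ, 3/10 ≤ a ∧ a < b ∧ b ≤ 12/25 ∧
      ThermalRadialPinning U a b ∧ SublinearSectorEntropy U a b) →
    Summit.HubbardSuperconductivity.HubbardSuperconductivity.Theses.ChiralWindow.CwThesis

end Summit.HubbardSuperconductivity.HubbardSuperconductivity.Cruxes.CwThesis.SymmetricRadialPinning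

/-! ### Proofs of FL1 and FL2 -/

namespace Summit.HubbardSuperconductivity.HubbardSuperconductivity.Cruxes.CwThesis.SymmetricRadialPinning

open Matrix Literature.MathematicalPhysics.QuantumLattice
open scoped ComplexOrder MatrixOrder

private theorem isHermitian_ofReal_smul' {m : Type} (c : ℝ) {A : Matrix m m ℂ}
    (hA : A.IsHermitian) : ((c : ℂ) • A).IsHermitian := by
  rw [IsHermitian, conjTranspose_smul, hA.eq]
  simp

/-- Discharge of FL1. -/
theorem goldenThompsonTransfer_holds : GoldenThompsonTransfer := by
  intro m _ _ _ H P hH hP β s hβ hs ψ hψ hHψ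
  have hPh : P.IsHermitian := hP.isHermitian
  -- the perturbed Hamiltonian
  set K : Matrix m m ℂ := H + (s : ℂ) • P with hK
  have hKh : K.IsHermitian := hH.add (isHermitian_ofReal_smul' s hPh)
  -- Step 1: variational principle  E₀(K) ≤ E₀(H) + s·p
  set p : ℝ := (star ψ ⬝ᵥ P *ᵥ ψ).re with hp
  have hray := groundEnergy_le_rayleigh_holds hKh ψ hψ
  have hKψ : star ψ ⬝ᵥ K *ᵥ ψ = (H.groundEnergy : ℂ) + (s : ℂ) * (star ψ ⬝ᵥ P *ᵥ ψ) := by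
    rw [hK, Matrix.add_mulVec, Matrix.smul_mulVec, dotProduct_add, dotProduct_smul, hHψ,
      dotProduct_smul, hψ]
    simp [smul_eq_mul]
  have h1 : K.groundEnergy ≤ H.groundEnergy + s * p := by
    have := hray
    rw [hKψ] at this
    simpa [Complex.add_re, Complex.mul_re, hp] using this
  -- Step 2: e^{-β E₀(K)} ≤ re Z_β(K)
  have h2 : Real.exp (-β * K.groundEnergy) ≤ (partitionFn β K).re := by
    rw [partitionFn_eq_sum_exp β hKh]
    obtain ⟨i₀, hi₀⟩ := Finite.exists_min hKh.eigenvalues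
    have hle : hKh.eigenvalues i₀ ≤ K.groundEnergy := by
      rw [groundEnergy_eq_iInf_eigenvalues_holds hKh]
      exact le_ciInf hi₀
    have hre : (∑ i, (Real.exp (-β * hKh.eigenvalues i) : ℂ)).re
        = ∑ i, Real.exp (-β * hKh.eigenvalues i) := by
      rw [Complex.re_sum]
      simp only [Complex.ofReal_re]
    rw [hre]
    calc Real.exp (-β * K.groundEnergy) ≤ Real.exp (-β * hKh.eigenvalues i₀) := by
          apply Real.exp_le_exp.mpr
          nlinarith
      _ ≤ ∑ i, Real.exp (-β * hKh.eigenvalues i) :=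
          Finset.single_le_sum (f := fun i => Real.exp (-β * hKh.eigenvalues i))
            (fun i _ => Real.exp_nonneg _) (Finset.mem_univ i₀)
  -- Step 3: Golden–Thompson  re Z_β(K) ≤ re tr (e^{-βH} X)
  set X : Matrix m m ℂ := NormedSpace.exp (-((β * s : ℝ) : ℂ) • P) with hX
  have hA : (-(β : ℂ) • H).IsHermitian := isHermitian_neg_smul β hH
  have hB : (-(β : ℂ) • ((s : ℂ) • P)).IsHermitian :=
    isHermitian_neg_smul β (isHermitian_ofReal_smul' s hPh)
  have hGT := goldenThompson_holds (𝕜 := ℂ) (-(β : ℂ) • H) (-(β : ℂ) • ((s : ℂ) • P)) hA hB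
  have hsum : -(β : ℂ) • H + -(β : ℂ) • ((s : ℂ) • P) = -(β : ℂ) • K := by
    rw [hK, smul_add]
  have hBX : NormedSpace.exp (-(β : ℂ) • ((s : ℂ) • P)) = X := by
    rw [hX, smul_smul]
    congr 2
    push_cast
    ring
  rw [hsum, hBX] at hGT
  have h3 : (partitionFn β K).re ≤ (gibbsWeight β H * X).trace.re := by
    simpa [partitionFn, gibbsWeight] using hGT
  -- Step 4: tr (e^{-βH} X) = Z_β(H) · ω_β(X), with Z_β(H) > 0 real
  have hZpos : 0 < partitionFn β H := partitionFn_pos β hH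
  have hZre : 0 < (partitionFn β H).re := (Complex.lt_def.mp hZpos).1
  have hZim : (partitionFn β H).im = 0 := by
    have := (Complex.lt_def.mp hZpos).2
    simpa using this.symm
  have hZne : partitionFn β H ≠ 0 := ne_of_gt hZpos
  have htr : (gibbsWeight β H * X).trace = partitionFn β H * gibbsState β H X := by
    rw [gibbsState_apply, ← mul_assoc, mul_inv_cancel₀ hZne, one_mul]
  have h4 : (gibbsWeight β H * X).trace.re = (partitionFn β H).re * (gibbsState β H X).re := by
    rw [htr, Complex.mul_re, hZim]
    ring
  -- Step 5: logarithms
  have hchain : Real.exp (-β * K.groundEnergy)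
      ≤ (partitionFn β H).re * (gibbsState β H X).re := by
    calc Real.exp (-β * K.groundEnergy) ≤ (partitionFn β K).re := h2
      _ ≤ (gibbsWeight β H * X).trace.re := h3
      _ = (partitionFn β H).re * (gibbsState β H X).re := h4
  have hωre : 0 < (gibbsState β H X).re := by
    have hprod : 0 < (partitionFn β H).re * (gibbsState β H X).re :=
      lt_of_lt_of_le (Real.exp_pos _) hchain
    exact pos_of_mul_pos_right hprod hZre.le
  have hlog : -β * K.groundEnergy
      ≤ Real.log (partitionFn β H).re + Real.log (gibbsState β H X).re := by
    have := Real.log_le_log (Real.exp_pos _) hchain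
    rwa [Real.log_exp, Real.log_mul (ne_of_gt hZre) (ne_of_gt hωre)] at this
  -- Step 6: combine
  have h1' : β * K.groundEnergy ≤ β * H.groundEnergy + β * s * p := by
    have := mul_le_mul_of_nonneg_left h1 hβ.le
    linarith [this]
  show -(Real.log (partitionFn β H).re + β * H.groundEnergy)
      - Real.log (gibbsState β H X).re ≤ β * s * p
  linarith

/-- Discharge of FL2. -/
theorem borelCantelliSelection_holds : BorelCantelliSelection := by
  intro a b hab B _hB hsum
  have hae : ∀ᵐ x ∂(MeasureTheory.volume : MeasureTheory.Measure ℝ),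
      ∀ᶠ k in Filter.atTop, x ∉ B k :=
    MeasureTheory.ae_eventually_notMem hsum
  by_contra hcon
  push Not at hcon
  have hsub : Set.Icc a b ⊆ {x | ¬ ∀ᶠ k in Filter.atTop, x ∉ B k} := fun x hx => hcon x hx
  have hnull : MeasureTheory.volume {x : ℝ | ¬ ∀ᶠ k in Filter.atTop, x ∉ B k} = 0 :=
    MeasureTheory.ae_iff.mp hae
  have h0 : MeasureTheory.volume (Set.Icc a b) = 0 :=
    MeasureTheory.measure_mono_null hsub hnull
  rw [Real.volume_Icc] at h0
  have hpos : (0 : ℝ) < b - a := sub_pos.mpr hab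
  have : ENNReal.ofReal (b - a) ≠ 0 := by
    simpa [ENNReal.ofReal_eq_zero, not_le] using hpos
  exact this h0

end Summit.HubbardSuperconductivity.HubbardSuperconductivity.Cruxes.CwThesis.SymmetricRadialPinning
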